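import Summits.Ventures.PercRepro.Night2FatXStructure

/-!
# night-2: the targets of a basis pair — coloops, the unloaded bottom level

General facts about the targets `T ⊇ Q = insert z B` of a basis pair `(B, z)` of the cell `(2, 1)` used by the
level-restricted forms of the face criterion (paper `proofs/NIGHT-2-g32.md` §1):

* `seven_le_card_sdiff_of_dload_ne_zero` / `dload_eq_zero_of_card_sdiff_le_six`: a loaded target strictly contains
  the six-point set `Q_b ∖ K` of a lossy big pair, so the bottom level `|T ∖ K| = 6` is NEVER loaded;
* `coloops_sdiff_subset_of_mem_tgtSets`: the coloops of `T ∖ K` lie in the basis `Q ∖ K` (a point of `T ∖ Q` is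
  in the closure of `Q ∖ K`, which spans `G ∖ K`), hence `card_coloops_sdiff_le_three_of_mem_tgtSets`;
* `vType_eq_of_card_sdiff_eq_six`: at a bottom-level target with at least two points of `G` off it the typed
  floor is exactly `max 0 (11/18 − L1 T)`.
-/

namespace PercRepro.Shadow

open PercRepro.ThmH PercRepro.PerFlat

variable {α : Type*} [DecidableEq α] {M : Matroid α} [M.Finite] {G : Finset α}

/-- **A loaded target has at least seven points off `K`**: it is `Q_b ∪ {x}` or `Q_b ∪ {x, x′}` for a lossy big pair
with `|Q_b ∖ K| ≥ 6` and `x ∉ Q_b`. -/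
theorem seven_le_card_sdiff_of_dload_ne_zero (hG : G ∈ flatsQ M (5 + 1)) (hd : (gr M \ G).card = 2)
    (hk : kColoops M G = 1) (hs : ∀ e ∈ gr M, ∀ f ∈ gr M, e ≠ f → rkN M {e, f} = 2)
    (hl : ∀ e ∈ gr M, M.Indep {e}) {S : Finset α}
    (hne : dload M 5 G (bigP M G) (dshGT2 M 5 G) S ≠ 0) : 7 ≤ (S \ coloops M G).card := by
  have hd' : (gr M \ G).card ≤ 5 := by omega
  obtain ⟨B, hB, hbig, z, hz, -, hcase⟩ := exists_pair_of_dload_ne_zero hG hd hk hs hl hne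
  have hKB : coloops M G ⊆ B := coloops_subset_of_mem_thinMembers hG hd' hB
  have hzB : z ∉ B := fun h => (Finset.mem_sdiff.1 hz).2 (subset_clF_of_subset_gr
    ((subset_G_of_mem_thinMembers hB).trans (mem_flatsQ.1 hG).1) h)
  have hzK : z ∉ coloops M G := fun h => hzB (hKB h)
  -- `|insert z B ∖ K| = |B ∖ K| + 1 ≥ 6`
  have h6 : 6 ≤ (insert z B \ coloops M G).card := by
    have : insert z B \ coloops M G = insert z (B \ coloops M G) := by
      ext e
      simp only [Finset.mem_sdiff, Finset.mem_insert]
      constructor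
      · rintro ⟨h1 | h1, h2⟩
        · exact Or.inl h1
        · exact Or.inr ⟨h1, h2⟩
      · rintro (rfl | ⟨h1, h2⟩)
        · exact ⟨Or.inl rfl, hzK⟩
        · exact ⟨Or.inr h1, h2⟩
    rw [this, Finset.card_insert_of_notMem (fun h => hzB (Finset.mem_sdiff.1 h).1)]
    omega
  rcases hcase with ⟨x, hx, rfl⟩ | ⟨p, hp, rfl⟩
  · have hxQ : x ∉ insert z B := notMem_of_mem_goodPts hx
    have hxK : x ∉ coloops M G := fun h => hxQ (Finset.mem_insert_of_mem (hKB h))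
    have : insert x (insert z B) \ coloops M G = insert x (insert z B \ coloops M G) := by
      ext e
      simp only [Finset.mem_sdiff, Finset.mem_insert]
      constructor
      · rintro ⟨h1 | h1, h2⟩
        · exact Or.inl h1
        · exact Or.inr ⟨h1, h2⟩
      · rintro (rfl | ⟨h1, h2⟩)
        · exact ⟨Or.inl rfl, hxK⟩
        · exact ⟨Or.inr h1, h2⟩
    rw [this, Finset.card_insert_of_notMem (fun h => hxQ (Finset.mem_sdiff.1 h).1)]
    omega
  · obtain ⟨⟨hp1, hp2⟩, -, -⟩ := mem_d2Pts.1 hp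
    have hp1Q : p.1 ∉ insert z B := (Finset.mem_sdiff.1 hp1).2
    have hp1K : p.1 ∉ coloops M G := fun h => hp1Q (Finset.mem_insert_of_mem (hKB h))
    have hsub : insert p.1 (insert z B \ coloops M G) ⊆ insert p.1 (insert p.2 (insert z B)) \ coloops M G := by
      intro e he
      rw [Finset.mem_insert] at he
      rw [Finset.mem_sdiff]
      rcases he with rfl | he
      · exact ⟨Finset.mem_insert_self _ _, hp1K⟩
      · rw [Finset.mem_sdiff] at he
        exact ⟨Finset.mem_insert_of_mem (Finset.mem_insert_of_mem he.1), he.2⟩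
    have := Finset.card_le_card hsub
    rw [Finset.card_insert_of_notMem (fun h => hp1Q (Finset.mem_sdiff.1 h).1)] at this
    omega

/-- **The bottom level is never loaded**: `dload T = 0` when `|T ∖ K| ≤ 6`. -/
theorem dload_eq_zero_of_card_sdiff_le_six (hG : G ∈ flatsQ M (5 + 1)) (hd : (gr M \ G).card = 2)
    (hk : kColoops M G = 1) (hs : ∀ e ∈ gr M, ∀ f ∈ gr M, e ≠ f → rkN M {e, f} = 2)
    (hl : ∀ e ∈ gr M, M.Indep {e}) {T : Finset α} (h6 : (T \ coloops M G).card ≤ 6) :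
    dload M 5 G (bigP M G) (dshGT2 M 5 G) T = 0 := by
  by_contra hne
  have := seven_le_card_sdiff_of_dload_ne_zero hG hd hk hs hl hne
  omega

/-- **The coloops of a target off `K` lie in the basis `Q ∖ K`**: a point of `T ∖ Q` is in the closure of `Q ∖ K`
(which spans `G ∖ K`), so it is not a coloop of `T ∖ K`. -/
theorem coloops_sdiff_subset_of_mem_tgtSets (hG : G ∈ flatsQ M (5 + 1)) (hd : (gr M \ G).card = 2)
    (hk : kColoops M G = 1) {B : Finset α} (hB : B ∈ thinMembers M 5 G) {z : α} (hz : z ∈ G \ clF M B)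
    {T : Finset α} (hT : T ∈ tgtSets M 5 G B z) :
    coloops M (T \ coloops M G) ⊆ insert z B \ coloops M G := by
  intro w hw
  rw [mem_coloops] at hw
  obtain ⟨hwT, hwcl⟩ := hw
  rw [Finset.mem_sdiff] at hwT ⊢
  refine ⟨?_, hwT.2⟩
  by_contra hwQ
  apply hwcl
  have hGg : G ⊆ gr M := (mem_flatsQ.1 hG).1
  have hTG : T ⊆ G := subset_G_of_mem_shadowAt (mem_tgtSets.1 hT).1
  have hQT : insert z B ⊆ T := (mem_tgtSets.1 hT).2.1
  -- `Q ∖ K ⊆ (T ∖ K).erase w` and `clF (Q ∖ K) = clF (G ∖ K) ∋ w`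
  have hsub : insert z B \ coloops M G ⊆ (T \ coloops M G).erase w := by
    intro e he
    rw [Finset.mem_sdiff] at he
    rw [Finset.mem_erase, Finset.mem_sdiff]
    exact ⟨fun h => hwQ (h ▸ he.1), hQT he.1, he.2⟩
  have hcl : clF M (insert z B \ coloops M G) = clF M (G \ coloops M G) := by
    apply clF_eq_clF_of_subset_clF_of_rkN_le (Finset.sdiff_subset.trans hGg)
    · exact (Finset.sdiff_subset_sdiff (Finset.insert_subset (Finset.mem_sdiff.1 hz).1
        (subset_G_of_mem_thinMembers hB)) (Finset.Subset.refl _)).trans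
        (subset_clF_of_subset_gr (Finset.sdiff_subset.trans hGg))
    · rw [rkN_sdiff_coloops_eq_five hG hk, rkN_insert_sdiff_coloops_eq_five_of_thin hG hd hk hB hz]
  have hw' : w ∈ clF M (insert z B \ coloops M G) := by
    rw [hcl]
    exact subset_clF_of_subset_gr (Finset.sdiff_subset.trans hGg) (Finset.mem_sdiff.2 ⟨hTG hwT.1, hwT.2⟩)
  exact clF_mono hsub hw'

/-- A target of a basis pair has at least six points off `K` (`Q ∖ K` and one more). -/
theorem six_le_card_sdiff_of_mem_tgtSets (hG : G ∈ flatsQ M (5 + 1)) (hd : (gr M \ G).card = 2)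
    (hk : kColoops M G = 1) {B : Finset α} (hB : B ∈ thinMembers M 5 G) (hnP : ¬ bigP M G B) {z : α}
    {T : Finset α} (hT : T ∈ tgtSets M 5 G B z) :
    6 ≤ (T \ coloops M G).card := by
  have hd' : (gr M \ G).card ≤ 5 := by omega
  have hB4 := card_sdiff_eq_four_of_not_bigP hG hd hk hB hnP
  have hKB : coloops M G ⊆ B := coloops_subset_of_mem_thinMembers hG hd' hB
  have hQT : insert z B ⊆ T := (mem_tgtSets.1 hT).2.1
  have h2 : 2 ≤ (T \ B).card := (mem_tgtSets.1 hT).2.2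
  -- `T ∖ K ⊇ (B ∖ K) ∪ (T ∖ B)`, disjoint, `|T ∖ B| ≥ 2`
  have hsub : (B \ coloops M G) ∪ (T \ B) ⊆ T \ coloops M G := by
    intro e he
    rw [Finset.mem_union, Finset.mem_sdiff, Finset.mem_sdiff] at he
    rw [Finset.mem_sdiff]
    rcases he with ⟨h1, h2⟩ | ⟨h1, h2⟩
    · exact ⟨hQT (Finset.mem_insert_of_mem h1), h2⟩
    · exact ⟨h1, fun h => h2 (hKB h)⟩
  have hdisj : Disjoint (B \ coloops M G) (T \ B) := by
    rw [Finset.disjoint_left]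
    intro e h1 h2
    exact (Finset.mem_sdiff.1 h2).2 (Finset.mem_sdiff.1 h1).1
  have := Finset.card_le_card hsub
  rw [Finset.card_union_of_disjoint hdisj] at this
  omega

/-- **A target of a basis pair has at most three coloops off `K`** (simple, loopless). -/
theorem card_coloops_sdiff_le_three_of_mem_tgtSets (hG : G ∈ flatsQ M (5 + 1)) (hd : (gr M \ G).card = 2)
    (hk : kColoops M G = 1) (hs : ∀ e ∈ gr M, ∀ f ∈ gr M, e ≠ f → rkN M {e, f} = 2)
    (hl : ∀ e ∈ gr M, M.Indep {e}) {B : Finset α} (hB : B ∈ thinMembers M 5 G) (hnP : ¬ bigP M G B) {z : α}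
    (hz : z ∈ G \ clF M B) {T : Finset α} (hT : T ∈ tgtSets M 5 G B z) :
    (coloops M (T \ coloops M G)).card ≤ 3 := by
  have hGg : G ⊆ gr M := (mem_flatsQ.1 hG).1
  have hTG : T ⊆ G := subset_G_of_mem_shadowAt (mem_tgtSets.1 hT).1
  have hQT : insert z B ⊆ T := (mem_tgtSets.1 hT).2.1
  apply card_coloops_le_three hs hl (Finset.sdiff_subset.trans (hTG.trans hGg))
  · -- `Q ∖ K ⊆ T ∖ K ⊆ G ∖ K`, the outer sets of rank `5`
    apply le_antisymm
    · rw [← rkN_sdiff_coloops_eq_five hG hk]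
      exact rkN_mono (Finset.sdiff_subset_sdiff hTG (Finset.Subset.refl _))
    · rw [← rkN_insert_sdiff_coloops_eq_five_of_thin hG hd hk hB hz]
      exact rkN_mono (Finset.sdiff_subset_sdiff hQT (Finset.Subset.refl _))
  · exact six_le_card_sdiff_of_mem_tgtSets hG hd hk hB hnP hT

/-- **The typed floor at a bottom-level target** (`|T ∖ K| = 6`, at least two points of `G` off `T`) is exactly
`max 0 (11/18 − L1 T)`: the bottom level is never loaded. -/
theorem vType_eq_of_card_sdiff_eq_six (hG : G ∈ flatsQ M (5 + 1)) (hd : (gr M \ G).card = 2)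
    (hk : kColoops M G = 1) (hs : ∀ e ∈ gr M, ∀ f ∈ gr M, e ≠ f → rkN M {e, f} = 2)
    (hl : ∀ e ∈ gr M, M.Indep {e}) {T : Finset α} (h6 : (T \ coloops M G).card = 6)
    (h2 : 2 ≤ (G \ T).card) : vType M G T = max 0 (11 / 18 - L1 M 5 G T) := by
  have h0 := dload_eq_zero_of_card_sdiff_le_six hG hd hk hs hl (le_of_eq h6)
  unfold vType
  rw [if_neg (by omega), if_pos h0]

end PercRepro.Shadow
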